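import Literature.AlgebraicGeometry.HodgeTheory.FermatDiagonalAction
import HarnessLib

/-!
# Eigenspaces of a single diagonal symmetry are sums of character eigenspaces
# (Katz 2009 §3; Shioda 1979 §1: the `μ`-eigenspace of `g_b^*` on `Hᵏ(X_F(ℂ); ℂ)` is `⊕ {V_χ : χ(b) = μ}`)

Family `hodge`, layer `Literature/AlgebraicGeometry/HodgeTheory`. PROOF FILE (theorems only: no definition, no named
fact, no instance; D-0026 net debt `0`). For a finite group `G ≤ diagonalStabilizer F` of diagonal symmetries of a
form `F ∈ ℂ[x₀, …, x_{n+1}]`, the tree's character decomposition `Hᵏ(X_F(ℂ); ℂ) = ⊕_χ V_χ`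
(`isInternal_diagonalCharacterEigenspace`, with the Serre projectors `π_χ`, file `DiagonalCharacterEigenspace`) says
how the WHOLE group acts; a consumer that meets ONE element `b ∈ G` (a deck transformation, an involution) needs the
eigenspaces of the single operator `g_b^*`. N. M. Katz, *Another look at the Dwork family* (2009), §3: "an
`R₀`-linear action of `G` on `M` gives an eigendecomposition `M = ⊕_{ρ ∈ D(G)} M(ρ)`"; reading one element `b`
through it, **the `μ`-eigenspace of `g_b^*` is the sum of the `V_χ` over the characters with `χ(b) = μ`**
(T. Shioda, *The Hodge conjecture for Fermat varieties*, Math. Ann. 245 (1979), §1: `V(α) = {ξ | g^*ξ = α(g)ξ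
(∀ g ∈ Gⁿₘ)}`, so a single `g` acts on `V(α)` by the scalar `α(g)`).

* `diagonalCharacterEigenspace_le_eigenspace` — `V_χ ⊆ ker (g_b^* − χ(b))`.
* `mem_iSup_diagonalCharacterEigenspace_of_apply_eq_smul` — an eigenvector `g_b^* c = μ c` lies in
  `⨆ {V_χ : χ(b) = μ}` (apply `π_χ` to `Σ_ψ (ψ(b) − μ) π_ψ c = 0`).
* **`eigenspace_diagonalPullback_eq_iSup`** — `ker (g_b^* − μ) = ⨆ {V_χ : χ(b) = μ}`.
* **`eigenspace_diagonalPullback_fermat_eq_iSup`** — for the Fermat variety `Xⁿₘ` and `a ∈ μₘⁿ⁺²`: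
  `ker (g_a^* − μ) = ⨆ {V(α) : χ_α(a) = μ}` (re-indexed by `α ∈ (ℤ/m)ⁿ⁺²`, `fermatCharacterEquiv`).

Written by the prover seat `hodge-nonav-19716-p2` (g5, cell `hodge-nonav`) as step F2 of the discharge, modulo the
geometric genus, of the binder hV of crux K1-B `VeryGeneralSignCommutatorsInHg` (route
`HodgeConjecture/SignSymmetricPowers`): the sign involution `ι = diag(−1,−1,1,1,1)` of the Fermat threefold `X³_d`
(`d` even, `ι ∈ μ_d⁵`) has `±1`-eigenspaces `⊕ {V(α) : (−1)^{α₀+α₁} = ±1}` on `H³`.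

## References

* [Katz2009] N. M. Katz, Another look at the Dwork family, Progr. Math. 269 (2009), §3.
* [Shioda1979HodgeFermat] T. Shioda, The Hodge conjecture for Fermat varieties, Math. Ann. 245 (1979), §1.
* [SerreLinearRepresentations1977] J.-P. Serre, Linear Representations of Finite Groups, §2.6 Thm. 8.
-/

noncomputable section

open CategoryTheory AlgebraicGeometry

namespace Literature.AlgebraicGeometry.HodgeTheory

open Literature.AlgebraicGeometry.Motives Literature.AlgebraicTopology.SingularHomology

variable {n : ℕ}

/-! ### One element of a finite group of diagonal symmetries -/

section General

variable (F : MvPolynomial (Fin (n + 2)) ℂ) {G : Subgroup (Fin (n + 2) → ℂˣ)} (hG : G ≤ diagonalStabilizer F)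
  (k : ℕ)

/-- **`V_χ ⊆ ker (g_b^* − χ(b))`**: a single symmetry `b ∈ G` acts on the character space `V_χ` by the scalar
`χ(b)`. [cite: Shioda1979HodgeFermat, §1] [cite: Katz2009, §3] -/
theorem diagonalCharacterEigenspace_le_eigenspace (χ : G →* ℂˣ) (b : G) :
    diagonalCharacterEigenspace F G χ k ≤
      Module.End.eigenspace (diagonalPullback F (hG b.2) k) ((χ b : ℂˣ) : ℂ) := by
  intro c hc
  rw [Module.End.mem_eigenspace_iff, diagonalPullback_apply]
  exact (mem_diagonalCharacterEigenspace_iff_diagonalMap hG).mp hc b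

/-- **An eigenvector of one symmetry lies in the sum of the matching character spaces**: if `g_b^* c = μ c`
(`b ∈ G`, `G` finite) then `c ∈ ⨆ {V_χ : χ(b) = μ}`. Proof: `c = Σ_ψ π_ψ c` (`sum_eigenProjector_apply`) and
`g_b^* π_ψ c = ψ(b) π_ψ c`, so `Σ_ψ (ψ(b) − μ) π_ψ c = 0`; applying `π_χ` (identity on `V_χ`, zero on `V_ψ`,
`ψ ≠ χ`) gives `(χ(b) − μ) π_χ c = 0`, i.e. `π_χ c = 0` unless `χ(b) = μ`. [cite: SerreLinearRepresentations1977, §2.6 Thm. 8]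
[cite: Katz2009, §3] -/
theorem mem_iSup_diagonalCharacterEigenspace_of_apply_eq_smul [Fintype G] [Fintype (G →* ℂˣ)] (b : G) {μ : ℂ}
    {c : complexBetti (SmoothHypersurface.hypersurface F) k}
    (hc : singularCohomology.map ℂ ℂ (diagonalMap F (hG b.2)) k c = μ • c) :
    c ∈ ⨆ χ : {χ : G →* ℂˣ // ((χ b : ℂˣ) : ℂ) = μ}, diagonalCharacterEigenspace F G χ.1 k := by
  classical
  -- `g_b^* (π_ψ c) = ψ(b) • π_ψ c`
  have hπ : ∀ ψ : G →* ℂˣ, singularCohomology.map ℂ ℂ (diagonalMap F (hG b.2)) k (eigenProjector F ψ k hG c) =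
      ((ψ b : ℂˣ) : ℂ) • eigenProjector F ψ k hG c := fun ψ ↦
    (mem_diagonalCharacterEigenspace_iff_diagonalMap hG).mp (eigenProjector_mem F hG c) b
  -- `Σ_ψ (ψ(b) − μ) • π_ψ c = 0`
  have hsum : ∑ ψ : G →* ℂˣ, (((ψ b : ℂˣ) : ℂ) - μ) • eigenProjector F ψ k hG c = 0 := by
    simp_rw [sub_smul]
    rw [Finset.sum_sub_distrib]
    have h1 : ∑ ψ : G →* ℂˣ, ((ψ b : ℂˣ) : ℂ) • eigenProjector F ψ k hG c =
        singularCohomology.map ℂ ℂ (diagonalMap F (hG b.2)) k c := by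
      simp_rw [← hπ]
      rw [← map_sum, sum_eigenProjector_apply F hG c]
    have h2 : ∑ ψ : G →* ℂˣ, μ • eigenProjector F ψ k hG c = μ • c := by
      rw [← Finset.smul_sum, sum_eigenProjector_apply F hG c]
    rw [h1, h2, hc, sub_self]
  -- apply `π_χ`: `(χ(b) − μ) • π_χ c = 0`
  have hχ : ∀ χ : G →* ℂˣ, ((χ b : ℂˣ) : ℂ) ≠ μ → eigenProjector F χ k hG c = 0 := by
    intro χ hne
    have h := congrArg (eigenProjector F χ k hG) hsum
    rw [map_sum, map_zero, Finset.sum_eq_single χ] at h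
    · rw [map_smul, eigenProjector_idem, smul_eq_zero] at h
      exact h.resolve_left (sub_ne_zero.mpr hne)
    · intro ψ _ hψ
      rw [map_smul, eigenProjector_apply_of_mem_of_ne F hG (eigenProjector_mem F hG c) hψ, smul_zero]
    · intro h; exact absurd (Finset.mem_univ χ) h
  -- `c = Σ_{χ(b) = μ} π_χ c`
  rw [← sum_eigenProjector_apply F hG c]
  refine Submodule.sum_mem _ fun χ _ ↦ ?_
  by_cases h : ((χ b : ℂˣ) : ℂ) = μ
  · exact Submodule.mem_iSup_of_mem ⟨χ, h⟩ (eigenProjector_mem F hG c)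
  · rw [hχ χ h]; exact Submodule.zero_mem _

/-- **The `μ`-eigenspace of a single diagonal symmetry is the sum of the character spaces with `χ(b) = μ`**:
`ker (g_b^* − μ) = ⨆ {V_χ : χ(b) = μ}` on `Hᵏ(X_F(ℂ); ℂ)`, for a finite `G ≤ diagonalStabilizer F` and `b ∈ G`
(Katz's eigendecomposition `M = ⊕ M(ρ)` read through one element). [cite: Katz2009, §3] [cite: Shioda1979HodgeFermat, §1] -/
theorem eigenspace_diagonalPullback_eq_iSup [Fintype G] [Fintype (G →* ℂˣ)] (b : G) (μ : ℂ) :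
    Module.End.eigenspace (diagonalPullback F (hG b.2) k) μ =
      ⨆ χ : {χ : G →* ℂˣ // ((χ b : ℂˣ) : ℂ) = μ}, diagonalCharacterEigenspace F G χ.1 k := by
  refine le_antisymm (fun c hc ↦ ?_) (iSup_le fun χ ↦ ?_)
  · rw [Module.End.mem_eigenspace_iff, diagonalPullback_apply] at hc
    exact mem_iSup_diagonalCharacterEigenspace_of_apply_eq_smul F hG k b hc
  · obtain ⟨χ, hχ⟩ := χ
    subst hχ
    exact diagonalCharacterEigenspace_le_eigenspace F hG k χ b

end General

/-! ### One element of `μₘⁿ⁺²` on the Fermat variety -/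

section Fermat

variable {m : ℕ}

/-- **The `μ`-eigenspace of `g_a^*`, `a ∈ μₘⁿ⁺²`, on `Hᵏ(Xⁿₘ(ℂ); ℂ)` is `⊕ {V(α) : χ_α(a) = μ}`** (`m ≥ 1`;
characters re-indexed by `α ∈ (ℤ/m)ⁿ⁺²` through `fermatCharacterEquiv`): Shioda's "`g^*ξ = α(g)ξ` on `V(α)`" read
for a single `g`. [cite: Shioda1979HodgeFermat, §1] [cite: Katz2009, §3] -/
theorem eigenspace_diagonalPullback_fermat_eq_iSup [NeZero m] (a : fermatGroup n m) (μ : ℂ) (k : ℕ) :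
    Module.End.eigenspace
        (diagonalPullback (fermatPolynomial ℂ n m) (fermatGroup_le_diagonalStabilizer m a.2) k) μ =
      ⨆ α : {α : Fin (n + 2) → ZMod m // ((fermatCharacter m α a : ℂˣ) : ℂ) = μ}, fermatEigenspace m α.1 k := by
  classical
  rw [eigenspace_diagonalPullback_eq_iSup (fermatPolynomial ℂ n m) (fermatGroup_le_diagonalStabilizer m) k a μ]
  -- re-index `χ ↦ α` along the bijection `fermatCharacterEquiv`
  let e : {α : Fin (n + 2) → ZMod m // ((fermatCharacter m α a : ℂˣ) : ℂ) = μ} ≃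
      {χ : fermatGroup n m →* ℂˣ // ((χ a : ℂˣ) : ℂ) = μ} :=
    (fermatCharacterEquiv (n := n) (m := m)).subtypeEquiv fun α ↦ Iff.rfl
  exact (e.iSup_congr fun _ ↦ rfl).symm

/-- Membership form: `g_a^* c = μ c` iff `c ∈ ⨆ {V(α) : χ_α(a) = μ}`. [cite: Shioda1979HodgeFermat, §1] -/
theorem map_diagonalMap_eq_smul_iff_mem_iSup_fermatEigenspace [NeZero m] (a : fermatGroup n m) (μ : ℂ) (k : ℕ)
    (c : complexBetti (SmoothHypersurface.hypersurface (fermatPolynomial ℂ n m)) k) :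
    singularCohomology.map ℂ ℂ (diagonalMap (fermatPolynomial ℂ n m) (fermatGroup_le_diagonalStabilizer m a.2)) k c =
        μ • c ↔
      c ∈ ⨆ α : {α : Fin (n + 2) → ZMod m // ((fermatCharacter m α a : ℂˣ) : ℂ) = μ}, fermatEigenspace m α.1 k := by
  rw [← eigenspace_diagonalPullback_fermat_eq_iSup, Module.End.mem_eigenspace_iff, diagonalPullback_apply]

end Fermat

end Literature.AlgebraicGeometry.HodgeTheory

end
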